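import Literature.AlgebraicGeometry.Resolution.NormalDegreePDefectless
import Mathlib.FieldTheory.IsAlgClosed.Basic
import HarnessLib

/-!
# Galois extensions of degree `p` of henselized inertially generated function fields: Cor. 4.2 from Prop. 4.1 (Kuhlmann 2010, §4)

Topic: `Literature/AlgebraicGeometry/Resolution` (valued function fields). Second layer of the
decomposition of the named fact `Kuhlmann2010NormalDegreePDefectless`
(`HenselizedFunctionFields.lean`), below `Kuhlmann2010GaloisDegreePDefectless`
(`NormalDegreePDefectless.lean`) = F.-V. Kuhlmann, *Elimination of ramification I: The
generalized stability theorem*, Trans. AMS 362 (2010) 5697–5727 = arXiv:1003.5678, **Cor. 4.2**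
in the residue-transcendental case over an algebraically closed `K`. The source derives Cor. 4.2
from Prop. 4.1:

> **Proposition 4.1.** Assume that `(K,v)` satisfies condition (4.1). Further, let `(F,v)` be of
> the form (4.2) or (4.3), and `(E|F,v)` a Galois extension of degree `p`. Then either `(E|F,v)`
> is defectless or there is a Galois extension `L|K` of degree `p` with non-trivial defect such
> that `(L.E|L.F,v)` is defectless.
>
> **Corollary 4.2.** Let `(F|K,v)` be a henselized inertially generated function field of
> transcendence degree 1 and rank 1. If `(K,v)` is a defectless field, then every Galois
> extension `(E|F,v)` of degree `p` is defectless.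

(a defectless `K` has no Galois extension of degree `p` with non-trivial defect; an
algebraically closed `K` has no Galois extension of degree `p` at all), and proves Prop. 4.1 in
the residue-transcendental case (4.3) by the normal forms of §4.3: Prop. 4.12 for `char K = p`
("Using Lemma 4.10, we derive the following normal form, which proves the equal characteristic
residue-transcendental case of Proposition 4.1") and Prop. 4.13 for `char K = 0` ("… which
proves the mixed characteristic residue-transcendental case of Proposition 4.1"; its last
sentence: "In all cases, `[Ē : F̄] = p`").

## Content

* NAMED FACTS, in the ambient specialisation of `NormalDegreePDefectless.lean` (`(Ω, V)`
  algebraically closed with `char Ωv = p > 0`, `K ≤ Ω` an algebraically closed subfield, `F` in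
  the class `IsHenselizedInertiallyGeneratedRT V K`, `F ≤ E` Galois of degree `p`):
  `Kuhlmann2010Prop41RTEqualChar` — Prop. 4.1, residue-transcendental case, `char K = p`
  (proved in the source by Prop. 4.12); `Kuhlmann2010Prop413ResidueDegree` — Prop. 4.13 (with
  Lemma 4.11), `char K = 0`: `[Ē : F̄] = p`.
* `not_isGaloisStep_of_isAlgClosed` — an algebraically closed `K ≤ Ω` has no Galois extension of
  degree `p` inside `Ω`; `charP_or_charZero_of_residueField` — `char Ω ∈ {0, p}` when
  `char Ωv = p`; `isDefectlessExtension_of_relfinrank_residueSubfield_eq` — `[Ē : F̄] = [E : F]`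
  forces `[E : F] = (vE : vF)·[Ē : F̄]` (fundamental inequality). PROVED.
* `Kuhlmann2010GaloisDegreePDefectless.of_parts` — Cor. 4.2 (the named fact of
  `NormalDegreePDefectless.lean`) from the two facts; `Kuhlmann2010NormalDegreePDefectless.of_parts'`
  — hence the parent fact from them (the purely inseparable case being discharged,
  `NormalDegreePDefectlessInseparable.lean` — not imported here; see
  `Kuhlmann2010NormalDegreePDefectless.of_galois`). PROVED.

## Sources

* F.-V. Kuhlmann, *Elimination of ramification I: The generalized stability theorem*, Trans.
  Amer. Math. Soc. 362 (2010) 5697–5727 = arXiv:1003.5678: §1 (1) (fundamental inequality),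
  §2.3 (defect), §2.5 (henselized inertially generated function fields, (2.7)), §4 ((4.1),
  (4.3), Prop. 4.1, Cor. 4.2), §4.2 (Lemmas 4.7, 4.10, 4.11), §4.3 (Props. 4.12, 4.13).

## Rendering notes

* Prop. 4.1 is printed under the standing hypothesis (4.1) of §4 ("`(K,v)` is henselian and
  `p = char K̄ > 0`, and `K` is closed under `p`-th roots") for `F` of the form (4.3)
  ("`F = K(x)^h(y)` is of rank 1, where `x` is residue-transcendental over `K`, `vy = 0`,
  `F̄ = K̄(x̄,ȳ)` with `K̄` relatively algebraically closed in `F̄`, and `K̄(x̄,ȳ)|K̄(x̄)` separable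
  with `[K̄(x̄,ȳ):K̄(x̄)] = [K(x,y):K(x)]`"). As in `NormalDegreePDefectless.lean`, the facts are
  vendored for an algebraically closed subfield `K ≤ Ω` with the restriction of `V` — henselian,
  of residue characteristic `p`, closed under `p`-th roots — and `F` in the class
  `IsHenselizedInertiallyGeneratedRT V K`, which is of the form (4.3) by §2.5, (2.7) and the
  paragraph before Lemma 2.26 (`vF = vK`, `K̄` algebraically closed); this is the specialisation
  p. 20 uses. "`char K = p`" / "`char K = 0`" are `CharP Ω p` / `CharZero Ω` (`K ≤ Ω`).
* "Galois extension `L|K` of degree `p` with non-trivial defect" = `IsGaloisStep p K L` with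
  `¬ IsDefectlessExtension V K L` (for the unique extension `V ∩ L` of the valuation of the
  henselian `K`; given `IsGaloisStep p K L`, `IsDefectlessExtension V K L` is exactly
  `d(L|K,v) = 1`); "`(L.E|L.F,v)` is defectless" = `IsDefectlessExtension V (L ⊔ F) (L ⊔ E)` with
  the composita taken in the lattice of subfields of `Ω` (§1.1: "`L.F` will denote the field
  compositum of `L` and `F` inside of `F̃`").
* Only the last sentence of Prop. 4.13 ("In all cases, `[Ē : F̄] = p`") is vendored, not the
  Kummer normal form `ϑ^p = r·u` itself nor the separability criterion; the ring `R` with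
  Frobenius-closed basis of Lemma 4.11 enters the printed statement only as an auxiliary choice
  ("Choose a ring `R` … as in Lemma 4.11"), whose existence is Lemma 4.11, so the residue degree
  conclusion is unconditional. This is weaker than print.
* What is NOT here: the proofs (§4.2: lifted Frobenius-closed bases, Lemmas 4.7–4.11, resting
  on [K5] Thm. 10 and Lemma 2.4; §4.3: the Artin–Schreier and Kummer normal forms, with
  Hensel's Lemma, Lemmas 2.9–2.10 and Cor. 2.11) — later layers.
-/

noncomputable section

open IsLocalRing

namespace Literature.AlgebraicGeometry.Resolution

universe u

/-! ### The two named facts -/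

/-- NAMED FACT — **Kuhlmann 2010, Prop. 4.1 in the residue-transcendental case (4.3), equal
characteristic** (proved in the source by the Artin–Schreier normal form of Prop. 4.12: "Using
Lemma 4.10, we derive the following normal form, which proves the equal characteristic
residue-transcendental case of Proposition 4.1"). Prop. 4.1: "Assume that `(K,v)` satisfies
condition (4.1). Further, let `(F,v)` be of the form (4.2) or (4.3), and `(E|F,v)` a Galois
extension of degree `p`. Then either `(E|F,v)` is defectless or there is a Galois extension
`L|K` of degree `p` with non-trivial defect such that `(L.E|L.F,v)` is defectless." Rendering:
`(Ω, V)` algebraically closed with `char Ω = char Ωv = p > 0`, `K ≤ Ω` a subfield which is an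
algebraically closed field (so `(K, V ∩ K)` satisfies (4.1)), `F` in the class
`IsHenselizedInertiallyGeneratedRT V K` (the form (4.3)), `F ≤ E` Galois of degree `p`
(`IsGaloisStep`); then `(E|F,v)` is defectless (`IsDefectlessExtension V F E`) or there is
`L ≤ Ω`, Galois of degree `p` over `K`, with `(L|K,v)` not defectless and `(L.E|L.F,v)`
defectless (composita `L ⊔ E`, `L ⊔ F` in `Ω`). Its proof is Prop. 4.12 with Lemmas 4.7–4.10
(lifted Frobenius-closed bases, [K5] Thm. 10), Lemma 4.9 and Hensel's Lemma, not in Mathlib.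
Users take `(h : Kuhlmann2010Prop41RTEqualChar)`.
[cite: Kuhlmann2010, Prop. 4.1 (residue-transcendental case (4.3), char `p`; with Prop. 4.12)] -/
def Kuhlmann2010Prop41RTEqualChar : Prop :=
  ∀ (Ω : Type u) [Field Ω] [IsAlgClosed Ω] (V : ValuationSubring Ω) (p : ℕ)
    [CharP (ResidueField V) p] [CharP Ω p],
    p.Prime → ∀ (K F E : Subfield Ω), IsAlgClosed K → IsHenselizedInertiallyGeneratedRT V K F →
    IsGaloisStep p F E →
    IsDefectlessExtension V F E ∨
      ∃ L : Subfield Ω, IsGaloisStep p K L ∧ ¬ IsDefectlessExtension V K L ∧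
        IsDefectlessExtension V (L ⊔ F) (L ⊔ E)

/-- NAMED FACT — **Kuhlmann 2010, Prop. 4.13 (with Lemma 4.11), mixed characteristic: the
residue degree of a Galois extension of degree `p` is `p`.** Prop. 4.13: "Let `K`, `F` and `E`
be as in the residue-transcendental case of Proposition 4.1, and assume that `char K = 0`. Choose
a ring `R` with Frobenius-closed basis `𝓑` in `F|K` as in Lemma 4.11. Then `E = F(ϑ)` where
`ϑ^p = ru` … In all cases, `[Ē : F̄] = p`, with the extension being separable if and only if
`r = 1` and `vcᵢ = (p/(p-1))vp` for all `i ∈ I`" (the ring `R` exists by Lemma 4.11). Only the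
residue degree conclusion is vendored. Rendering: `(Ω, V)` algebraically closed with
`char Ω = 0`, `char Ωv = p > 0`, `K ≤ Ω` an algebraically closed subfield, `F` in
`IsHenselizedInertiallyGeneratedRT V K`, `F ≤ E` Galois of degree `p`; then
`[Ev : Fv] = p` for the residue subfields `Fv ≤ Ev ≤ Ωv` of `V ∩ F ⊆ V ∩ E`. Its proof is the
Kummer normal form of §4.3 (with Lemmas 2.9–2.10, Cor. 2.11, Lemma 4.9, Lemma 4.11 and Hensel's
Lemma), not in Mathlib. Users take `(h : Kuhlmann2010Prop413ResidueDegree)`.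
[cite: Kuhlmann2010, Prop. 4.13 (last assertion) and Lemma 4.11] -/
def Kuhlmann2010Prop413ResidueDegree : Prop :=
  ∀ (Ω : Type u) [Field Ω] [IsAlgClosed Ω] [CharZero Ω] (V : ValuationSubring Ω) (p : ℕ)
    [CharP (ResidueField V) p],
    p.Prime → ∀ (K F E : Subfield Ω), IsAlgClosed K → IsHenselizedInertiallyGeneratedRT V K F →
    IsGaloisStep p F E →
    (residueSubfield F V).relfinrank (residueSubfield E V) = p

/-! ### Lemmas for the assembly -/

section Lemmas

variable {Ω : Type u} [Field Ω] (V : ValuationSubring Ω)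

/-- **An algebraically closed subfield `K ≤ Ω` has no Galois extension of degree `p ≠ 1` inside
`Ω`**: a Galois extension is algebraic, and every element of `Ω` algebraic over `K` lies in `K`
(`IntermediateField.eq_bot_of_isAlgClosed_of_isAlgebraic`), so the degree is `1`. This is how Cor. 4.2
follows from Prop. 4.1 over an algebraically closed (or just defectless) `K`. [folklore] -/
theorem not_isGaloisStep_of_isAlgClosed {p : ℕ} (hp : p ≠ 1) {K L : Subfield Ω}
    (hK : IsAlgClosed K) (h : IsGaloisStep p K L) : False := by
  obtain ⟨hle, hdeg, hgal⟩ := h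
  haveI := hK
  haveI := hgal
  haveI : Algebra.IsAlgebraic K (Subfield.extendScalars hle) :=
    Algebra.IsSeparable.isAlgebraic K _
  have hbot : Subfield.extendScalars hle = ⊥ :=
    IntermediateField.eq_bot_of_isAlgClosed_of_isAlgebraic _
  rw [hbot, IntermediateField.finrank_bot] at hdeg
  exact hp hdeg.symm

/-- **`char Ω` is `p` or `0` when `char Ωv = p` is prime**: the characteristic of the field `Ω`
is `0` or a prime `q`, and `q = 0` in `Ω` gives `q = 0` in `Ωv`, so `p ∣ q`. [folklore] -/
theorem charP_or_charZero_of_residueField {p : ℕ} (hp : p.Prime) [CharP (ResidueField V) p] :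
    CharP Ω p ∨ CharZero Ω := by
  obtain ⟨q, hq⟩ := CharP.exists Ω
  rcases CharP.char_is_prime_or_zero Ω q with hqprime | hq0
  · left
    -- `q = 0` in `Ωv`, so `p ∣ q`, so `q = p`
    haveI : CharP V q := V.subtype.charP Subtype.val_injective q
    have h0 : (q : ResidueField V) = 0 := by
      rw [← map_natCast (algebraMap V (ResidueField V)) q, CharP.cast_eq_zero, map_zero]
    have hdvd : p ∣ q := (CharP.cast_eq_zero_iff (ResidueField V) p q).mp h0
    have hqp : q = p := ((Nat.dvd_prime hqprime).mp hdvd).resolve_left hp.ne_one |>.symm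
    subst hqp
    exact hq
  · right
    subst hq0
    exact CharP.charP_to_charZero Ω

variable {V}

/-- **`[Ev : Fv] = [E : F]` forces defectlessness**: by the fundamental inequality
`(vE : vF)·[Ev : Fv] ≤ [E : F]` with `(vE : vF) ≥ 1`, equality of the residue degree with the
degree gives `(vE : vF) = 1` and `[E : F] = (vE : vF)·[Ev : Fv]`. [cite: Kuhlmann2010, Section 1, (1)] -/
theorem isDefectlessExtension_of_relfinrank_residueSubfield_eq {F E : Subfield Ω} (hle : F ≤ E)
    (hpos : 0 < Subfield.relfinrank F E)
    (hf : (residueSubfield F V).relfinrank (residueSubfield E V) = Subfield.relfinrank F E) :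
    IsDefectlessExtension V F E := by
  obtain ⟨he, -, hef⟩ := relIndex_mul_relfinrank_le_relfinrank V hle hpos
  rw [hf] at hef
  -- `e·n ≤ n` with `n > 0` forces `e = 1`
  have he1 : (valueSubgroup F V).relIndex (valueSubgroup E V) = 1 := by
    have h1 : (valueSubgroup F V).relIndex (valueSubgroup E V) * Subfield.relfinrank F E ≤
        1 * Subfield.relfinrank F E := by rw [one_mul]; exact hef
    exact le_antisymm (Nat.le_of_mul_le_mul_right h1 hpos) he
  refine ⟨hle, hpos, ?_⟩
  rw [he1, one_mul, hf]

end Lemmas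

/-! ### Assembly: Cor. 4.2 from Prop. 4.1 / Prop. 4.13 -/

/-- **Kuhlmann 2010, Cor. 4.2 (residue-transcendental case over an algebraically closed `K`)
from Prop. 4.1 (equal characteristic) and Prop. 4.13 (mixed characteristic).** PROVED: `char Ω`
is `p` or `0` (`charP_or_charZero_of_residueField`). If `char Ω = p`, Prop. 4.1
(`Kuhlmann2010Prop41RTEqualChar`) gives the defectlessness of `(E|F,v)` or a Galois extension of
degree `p` of the algebraically closed `K`, which does not exist
(`not_isGaloisStep_of_isAlgClosed`). If `char Ω = 0`, Prop. 4.13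
(`Kuhlmann2010Prop413ResidueDegree`) gives `[Ē : F̄] = p = [E : F]`, whence
`[E : F] = (vE : vF)·[Ē : F̄]` by the fundamental inequality
(`isDefectlessExtension_of_relfinrank_residueSubfield_eq`).
[cite: Kuhlmann2010, Cor. 4.2 (with Prop. 4.1 and Prop. 4.13)] -/
theorem Kuhlmann2010GaloisDegreePDefectless.of_parts (h41 : Kuhlmann2010Prop41RTEqualChar.{u})
    (h413 : Kuhlmann2010Prop413ResidueDegree.{u}) : Kuhlmann2010GaloisDegreePDefectless.{u} := by
  intro Ω _ _ V p _ hp K F E hK hF hstep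
  rcases charP_or_charZero_of_residueField V hp with hcp | hc0
  · haveI := hcp
    rcases h41 Ω V p hp K F E hK hF hstep with hdef | ⟨L, hL, -, -⟩
    · exact hdef
    · exact (not_isGaloisStep_of_isAlgClosed hp.ne_one hK hL).elim
  · haveI := hc0
    have hf := h413 Ω V p hp K F E hK hF hstep
    obtain ⟨hle, hdeg, -⟩ := hstep
    have hrel : Subfield.relfinrank F E = p := by
      rw [Subfield.relfinrank_eq_finrank_of_le hle, hdeg]
    have hpos : 0 < Subfield.relfinrank F E := by
      rw [hrel]
      exact hp.pos
    exact isDefectlessExtension_of_relfinrank_residueSubfield_eq hle hpos (hf.trans hrel.symm)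

/-- **The parent fact `Kuhlmann2010NormalDegreePDefectless` from Prop. 4.1 (char `p`),
Prop. 4.13 (char `0`) and the purely inseparable case** (`of_cases` with `of_parts`). PROVED.
[cite: Kuhlmann2010, Section 5, proof of (R4) (p. 20), with Cor. 4.2 and Prop. 3.1] -/
theorem Kuhlmann2010NormalDegreePDefectless.of_parts' (h41 : Kuhlmann2010Prop41RTEqualChar.{u})
    (h413 : Kuhlmann2010Prop413ResidueDegree.{u})
    (hI : Kuhlmann2010PurelyInseparableDegreePDefectless.{u}) :
    Kuhlmann2010NormalDegreePDefectless.{u} :=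
  Kuhlmann2010NormalDegreePDefectless.of_cases
    (Kuhlmann2010GaloisDegreePDefectless.of_parts h41 h413) hI

end Literature.AlgebraicGeometry.Resolution
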